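import Literature.MathematicalPhysics.QuantumFieldTheory.Balaban1983to89.B9SectBH1GProbesY
import Literature.MathematicalPhysics.QuantumFieldTheory.Balaban1983to89.B9SectBH1GUndiffY
import Literature.MathematicalPhysics.QuantumFieldTheory.Balaban1983to89.B9SectBH1GFrameV6
import Literature.MathematicalPhysics.QuantumFieldTheory.Balaban1983to89.B9SectBGFrameCodedY

/-!
# `Balaban1983to89.B9SectBH1GFrameCodedY` — ★★ THE (3.43) TRANSFER FIELD OF THE BOND-SECTOR FRAME PROVED AT NODE 00's LETTERS: `h1G_transfer_KACU` (the field
# `B9SectBH1GFrameV6.H1GFrame₆.h1G_transfer` for `GA := KACU G x (GAY parS parB (GpY parS)) parB C37 C38`, `Gb := GbC`), the writing function `wHG6`, ★★★ the instance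
# `h1GFrame₆CodedOn := { gFrame₅CodedOn … with … }` and ★★ `stepH1Pos_KACU_frame_on` (pub-ymgap N06 row 13: the (3.43) member of `B9SectBCodedReadingsU.SectBStepU`,
# G side, Route L)

T. Bałaban, *Propagators for lattice gauge theories in a background field*, Commun. Math. Phys. **99** (1985) 389–434
[`Balaban1985BackgroundPropagators`, "B9"]; [4] = T. Bałaban, *Propagators and renormalization transformations for lattice gauge
theories. II*, Commun. Math. Phys. **96** (1984) 223–250 [`Balaban1984PropagatorsII`].

statement-level skeleton of published theorems with citation tags; proofs where landed; nothing here is a claim about the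
Yang–Mills mass gap

THE PRINTED LOCI.  Theorem 3.4 p. 400 and p. 403 l. 1–9 (*"the same inequalities hold for … G(U′U) … of course with different constants"*, the letters `∇_U`, `U(Γ)` of
the base `U`); Theorem 3.3 p. 399 (`G(U)` satisfies (3.42)–(3.45)); (3.43) p. 398; (3.40) p. 397; (3.82)–(3.86) p. 407 (the expansion `G(U′U) = Σ (G(U)V(A))ⁿG(U)`); [4]
Lemma 2.1 p. 234, (2.51)–(2.52) p. 232, (2.60) p. 234 with (2.2) p. 224 (neighbouring blocks differ by at most one level).

WHY THIS FILE (seat dag-n06-c gen 14; the first Hölder member of the G side of row 13).  Gen 13 instantiated the G frame `GFrame₅` at NODE 00's letters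
(`B9SectBGFrameCodedY.gFrame₅CodedOn`, 40 fields) and landed the V5 Hölder frame `H1GFrame₅` whose ONE further field `h1G_transfer` — r06's per-PROBE left∕right
(3.43) transfers for the letter `Gb(U′U)` ⇒ the (3.43) block of the family at `U′U` — remained to be proved at the letters.  THIS FILE proves it (on V6, LOCATED-14:
the writing function must see `B₀`) for the coded bond family `KACU` with def-Y's U-letter Hölder reading (R13-U1): §1 the output writing function `wHG6`; §2 ★★
`h1G_transfer_KACU`: the probes are gen 14's `probeBC` at the admissible pairs (anchor = the labelled block `ιB(βy)` of the output block `y`, through a site of that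
block), the LEFT premise and the right premises (b′-backward)∕(c′) are READ from the (3.43) block at the base (`probeL∕R_lamB_le`), the right-forward letters of (b′)
through the CROSS read `probe_crossB_lamB_le`, the premise (a′) from the (3.42) majorants (`readG342Y_KACU` transported) by the product rule `probeB_undiff_le`
under the DISPLAYED bond transporter law `HolderLipBY` and the level comparability `len_le_of_dist_lt_M_geo9K`; the conclusions at `μ := coord(bondFunCoords(J ⊗ E))`
bound every admissible pair probe of the two printed words of `G(U′U)`, and `h1ReadB_le_of_probes` WRITES the block.  §3 the instance `h1GFrame₆CodedOn` and the step
`stepH1Pos_KACU_frame_on` (r06's `stepH1Pos_of_h1GFrame₆`).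
DISPLAYED HYPOTHESES beyond those of `B9SectBGFrameCodedY.stepEPos_KACU_frame_on`: `hLipB` (`Reg335 ⇒ HolderLipBY c_Lip r_L (parB U) U`: covariant Lipschitz of
the bond transporter on admissible pairs — for def-Y's `parBY` = n06-w6's `B9Eq340TaxiTelescope` + a taxi-contour locality lemma, not typed) and `hMr : r_L + 1 < MInv`.
HONEST SCOPE.  Kernel bookkeeping: r06's theorems are CALLED, def-Y's letters READ and WRITTEN; nothing of [B9] asserted beyond the landed modules; the transporter law
is displayed; COUNT-NEUTRAL; N06 NOT discharged; one finite lattice programme at fixed ε — nothing continuum, nothing about OS positivity or the mass gap.  No `sorry`,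
no `axiom`, no `instance`, no `notation`.  Seat `pub-ymgap-dag-n06-c` (g14), 2026-08-28; `--supports stmt-QuantumFields-27364`.
-/

noncomputable section

namespace Literature.MathematicalPhysics.QuantumFieldTheory.Balaban1983to89.B9SectBH1GFrameCodedY

open LatticeFieldCalculus (supDist)
open B9Eq39Adjoint (R R_smul R_zero R_sub R_add)
open B6GlobalChartV1 (PV blkV1 boxEquiv)
open B6Geom246MultiLevelTorus (geomT)
open B6Ineq2142KLevelV1 (β beta_level)
open B6KLevelCensusIndexV1 (KIdx Adm kGeo)
open B6RandomWalk (HasMajorant hasMajorant_mono BlockSupp Ineq261)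
open B9Thm34Ext (toB6)
open B9FromB6 (EBlock H1Block)
open B9GeoNormsKLevelV1 (geo9K geo9K_dist_nonneg)
open B9GeoLemma21KLevelV1 (geo9Y_dist_comm geo9Y_dist_triangle geo9Y_len_pos one_le_k)
open B9Eq310Hermitian (norm_R_le)
open B9Eq352DivFormLetters (conj coordEquiv conj_mul)
open B9Eq352GradLetters (diffLetter)
open B9Eq371GradLetters (bT bU)
open B9CoReadingCoords (cdBₗ cdsBₗ cdBₗ_apply cdsBₗ_apply)
open B9PinMembersKLevelV1 (MemberY geo9Y bg9Y)
open B9Eq360DeltaPrimeAY (AfldY)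
open B9SectBGpLettersY (GVal decY decY_base blkC coordC norm_le_one_and_inv_of_mem)
open B9SectBL2DictionaryY (coordC_base_eq)
open B9SectBGpFrameCodedY (codingYx CplxLettersY)
open B9SectBGpReadingsY (KSC baseY)
open B9SectBCodedCarrier (CCfg pullS)
open B9SectBCodedReadingsU (KACU)
open B9SectBKerFrameCodedY (CinvY)
open B9SectBStepWhole (StepPos StepH1Pos)
open B9RWSumsReadsNbr (nbr mem_nbr)
open B9RWSumsCompleteGeo9YNbr (len_le_of_dist_lt_M_geo9K)
open B9GeoNormsKLevelModelSignsV1 (modelSignsOn_geo9K)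
open Node00 (SiteY BlkY FBondY IBondY CfgY BallY SiteParY BondParY BondOpY liftY liftY_apply holderQB cdB cdsB UboxY shiftY GAY GpY XY deltaAY deltaPrimeAY
  bondCoordsY bondFunCoordsY)
open B9SectBGWordDeltaAY (bondOpCoordsRY GbC)
open B9SectBGReadCodedY (eta_inv_eq_abs_cf hasMajorant_of_eq hasMajorant_conj_bondOpCoordsRY GbC_eq_conj_bondOpCoordsRY bondOpCoordsRY_mul)
open B9SectBGReadY (readG342Y_KACU)
open B9SectBGFrameCodedY (gFrame₅CodedOn cXY cXY_nonneg parB_contractive)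
open B9SectBGClassLettersY (Reg335PlaqY CplxLettersGY VarParBY)
open B9SectBH1GFrameV6 (H1GFrame₆ stepH1Pos_of_h1GFrame₆)
open B9SectBH1GReadWriteY (probeB norm_probeB norm_probeB_neg h1ReadB h1ReadB_le_of_probes KACU_h1_inr_eq KACU_h1_off probeB_apply)
open B9SectBH1GProbesY (lamB lamB_GbC lamB_DL_GbC lamB_GbC_DR lamB_GbC_DF lamB_conj_bondOpCoordsRY lamB_coordEquiv_bondFunCoordsY norm_map_symm_mul_diffLetter_inr
  norm_map_symm_mul_diffLetter_inl probeBC probeBC_symm blockSupp_coordEquiv_bondFun_liftY probeL_lamB_le probeR_lamB_le norm_lamB_le_of_hasMajorant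
  probe_crossB_lamB_le)
open B9SectBH1GUndiffY (HolderLipBY lenB lenB_pos probeB_undiff_le cutH_inr_nonneg)

variable {d ℓ : ℕ} {hd : 1 ≤ d + 1} {hL : Odd (ℓ + 1) ∧ 1 < ℓ + 1} {b₀ b₁ : ℝ} {Mstar : ℕ}
variable {𝔸 : Type} [NormedRing 𝔸] [NormedAlgebra ℂ 𝔸] [CompleteSpace 𝔸]

/-! ## §1 The output writing function and two real-power bookkeeping lemmas -/

/-- the output writing function of the instance: `wHG6 … B₀ B δc Bβ β = M₂·B·(B_hL + B_hR)` with `B_hL = Σ‖b_j‖·B⁺_β`,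
`B_hR = Σ‖b_j‖·B⁺_β·(1 + m_N·M₂Σ‖b_j‖·e^{2(d+1)δc}) + Σ‖b_j‖·c_R·B₀·(L³e^{δc} + c_Lip·L²·e^{δc(r_L+1)})`, `B⁺_β = max (Bβ β) 0`.
[cite: Balaban1985BackgroundPropagators, Thm 3.4 p.400, Thm 3.3 p.399, (3.43) p.398, p.403 («of course with different constants»)] -/
def wHG6 (dd L Sb M₂ cR cLip rL : ℝ) (mN : ℕ) (B₀ B δc : ℝ) (Bβ : ℝ → ℝ) : ℝ → ℝ := fun β =>
  M₂ * B * (Sb * max (Bβ β) 0 +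
    (Sb * max (Bβ β) 0 * (1 + (mN : ℝ) * (M₂ * Sb) * Real.exp (δc * dd)) + Sb * (cR * B₀) * (L ^ 3 * Real.exp δc + cLip * L ^ 2 * Real.exp (δc * (rL + 1)))))

omit [NormedAlgebra ℂ 𝔸] [CompleteSpace 𝔸] [NormedRing 𝔸] in
/-- `0 ≤ wHG6` for nonnegative data. [cite: Balaban1985BackgroundPropagators, (3.43) p.398, bookkeeping] -/
theorem wHG6_nonneg {dd L Sb M₂ cR cLip rL : ℝ} (mN : ℕ) {B₀ B δc : ℝ} (Bβ : ℝ → ℝ) (hL : 0 ≤ L) (hSb : 0 ≤ Sb) (hM₂ : 0 ≤ M₂) (hcR : 0 ≤ cR)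
    (hcLip : 0 ≤ cLip) (hB₀ : 0 ≤ B₀) (hB : 0 ≤ B) (β : ℝ) : 0 ≤ wHG6 dd L Sb M₂ cR cLip rL mN B₀ B δc Bβ β := by
  unfold wHG6
  have h0 : 0 ≤ max (Bβ β) 0 := le_max_right _ _
  positivity

omit [NormedAlgebra ℂ 𝔸] [CompleteSpace 𝔸] [NormedRing 𝔸] in
/-- `(t∕L)^{−β}·t² ≤ L·t^{2−β}` for `0 < t`, `1 ≤ L`, `0 ≤ β ≤ 1`. [cite: Balaban1984PropagatorsII, (2.1) p.224, bookkeeping] -/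
theorem div_rpow_neg_mul_sq_le {t L β : ℝ} (ht : 0 < t) (hL : 1 ≤ L) (hβ1 : β ≤ 1) : (t / L) ^ (-β) * t ^ 2 ≤ L * t ^ (2 - β) := by
  have hL0 : 0 < L := lt_of_lt_of_le one_pos hL
  have h1 : (t / L) ^ (-β) = L ^ β * t ^ (-β) := by
    rw [Real.div_rpow ht.le hL0.le, Real.rpow_neg ht.le, Real.rpow_neg hL0.le]
    field_simp
  have h2 : L ^ β ≤ L := by
    conv_rhs => rw [← Real.rpow_one L]
    exact Real.rpow_le_rpow_of_exponent_le hL hβ1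
  have h3 : t ^ (-β) * t ^ 2 = t ^ (2 - β) := by
    rw [show t ^ 2 = t ^ (2 : ℝ) from (Real.rpow_natCast t 2).symm ▸ by norm_num, ← Real.rpow_add ht]; ring_nf
  calc (t / L) ^ (-β) * t ^ 2 = L ^ β * (t ^ (-β) * t ^ 2) := by rw [h1]; ring
    _ ≤ L * (t ^ (-β) * t ^ 2) := mul_le_mul_of_nonneg_right h2 (mul_nonneg (Real.rpow_nonneg ht.le _) (sq_nonneg _))
    _ = L * t ^ (2 - β) := by rw [h3]

omit [NormedAlgebra ℂ 𝔸] [CompleteSpace 𝔸] [NormedRing 𝔸] in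
/-- `(L·t)^{1−β}·t ≤ L·t^{2−β}` for `0 < t`, `1 ≤ L`, `0 ≤ β ≤ 1`. [cite: Balaban1984PropagatorsII, (2.1) p.224, bookkeeping] -/
theorem mul_rpow_mul_le {t L β : ℝ} (ht : 0 < t) (hL : 1 ≤ L) (hβ0 : 0 ≤ β) : (L * t) ^ (1 - β) * t ≤ L * t ^ (2 - β) := by
  have hL0 : 0 < L := lt_of_lt_of_le one_pos hL
  rw [Real.mul_rpow hL0.le ht.le]
  have h2 : L ^ (1 - β) ≤ L := by
    conv_rhs => rw [← Real.rpow_one L]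
    exact Real.rpow_le_rpow_of_exponent_le hL (by linarith)
  have h3 : t ^ (1 - β) * t = t ^ (2 - β) := by
    conv_lhs => rw [show t ^ (1 - β) * t = t ^ (1 - β) * t ^ (1 : ℝ) by rw [Real.rpow_one]]
    rw [← Real.rpow_add ht]; ring_nf
  calc L ^ (1 - β) * t ^ (1 - β) * t = L ^ (1 - β) * (t ^ (1 - β) * t) := by ring
    _ ≤ L * (t ^ (1 - β) * t) := mul_le_mul_of_nonneg_right h2 (mul_nonneg (Real.rpow_nonneg ht.le _) ht.le)
    _ = L * t ^ (2 - β) := by rw [h3]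

/-! ## §2 ★★ The transfer field of the (3.43) frame PROVED at def-Y's bond letters for `KACU` -/

section Transfer

variable [NormOneClass 𝔸] (c35 : ℝ) (G : Subgroup 𝔸ˣ) (x : MemberY d ℓ hd hL b₀ b₁ Mstar) (par : SiteParY 𝔸 x.toKIdx) (parB : BondParY 𝔸 x.toKIdx)
  {ι : Type} [Fintype ι] (b : Module.Basis ι ℝ 𝔸) (ιB : BlkY x.toKIdx → IBondY x.toKIdx) [Fintype (geo9Y x).Site]
  (C37 C38 : ℝ → CfgY 𝔸 x.toKIdx → AfldY 𝔸 x.toKIdx → Prop)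

set_option maxHeartbeats 1600000 in
/-- ★★ **THE TRANSFER FIELD OF THE (3.43) BOND-SECTOR FRAME, PROVED FOR `KACU` AT def-Y's LETTERS** (see the module header for the proof plan): from r06's per-probe
left and right Hölder transfers for the letter `GbC` of the member (hypotheses `HL`, `HR`, the shapes of `H1GFrame₆.h1G_transfer`), the (3.42)∕(3.43) blocks of
`KACU` at the base, the bond transporter law `HolderLipBY` at the regular base and the neighbour count, the (3.43) block of `KACU` at the coded product with
`(wHG6 … B₀ B δc Bβ, δc∕6)`.
[cite: Balaban1985BackgroundPropagators, Thm 3.4 p.400, Thm 3.3 p.399, (3.43) p.398, (3.40) p.397, p.403 l.1–9, (3.82)–(3.86) p.407; Balaban1984PropagatorsII, (2.51)–(2.52) p.232, Lemma 2.1 p.234, (2.60) p.234] -/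
theorem h1G_transfer_KACU (hι : ∀ s : BlkY x.toKIdx, β x.toKIdx.hN x.toKIdx.D x.toKIdx.hk (ιB s) = s)
    (hG1 : ∀ u : 𝔸ˣ, u ∈ G → ‖(u : 𝔸)‖ ≤ 1) (hparB : ∀ U : CfgY 𝔸 x.toKIdx, GVal G x.toKIdx U → ∀ s s', parB U s s' ∈ G)
    {M₂ : ℝ} (hM₂ : 0 ≤ M₂) (hrepr : ∀ (v : 𝔸) (j : ι), |b.repr v j| ≤ M₂ * ‖v‖)
    {cLip rL : ℝ} (hcLip : 0 ≤ cLip) (hrL : 0 ≤ rL)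
    (hLipB : ∀ (α₀ : ℝ) (U : CfgY 𝔸 x.toKIdx), (bg9Y 𝔸 G x).Reg335 c35 α₀ U → HolderLipBY x.toKIdx cLip rL (parB U) U)
    {MInv : ℝ} {mN : ℕ} (hnbr : MInv ≤ (geo9Y x).M → ∀ y' : IBondY x.toKIdx, (nbr (geo9Y x) (2 * ((d : ℝ) + 1)) y').card ≤ mN)
    (hMr : rL + 1 < MInv) (cRG : ℝ → ℝ) {aInv aW : ℝ}
    (α₀ : ℝ) (c c' : (codingYx G x C37 C38).bg.Cfg) (α₁ B₀ B δ δc : ℝ) (Bβ : ℝ → ℝ)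
    (hM : MInv ≤ (geo9Y x).M) (_hα₀ : 0 < α₀) (_hMa : (geo9Y x).M * α₀ ≤ aInv) (hreg : (codingYx G x C37 C38).bg.Reg335 c35 α₀ c)
    (_hα₁ : 0 < α₁) (_haW : α₁ ≤ aW) (h37 : (codingYx G x C37 C38).bg.Cplx337 α₁ c c') (hB₀ : 0 < B₀) (hB : 0 ≤ B)
    (_hδ : 0 < δ) (hδc : 0 < δc) (hδcδ : δc ≤ δ) (hcRG : M₂ * (∑ j, ‖b j‖) ≤ cRG δ)
    (hE : EBlock (KACU G x (GAY x.toKIdx par parB (GpY x.toKIdx par)) parB C37 C38) B₀ δ c)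
    (hH1 : H1Block (KACU G x (GAY x.toKIdx par parB (GpY x.toKIdx par)) parB C37 C38) Bβ δ c)
    (HL : ∀ (D : Module.End ℝ ((Fin (d + 1) × SiteY x.toKIdx) × ι → ℝ)) (Φ : (Fin (d + 1) × SiteY x.toKIdx → 𝔸) →ₗ[ℝ] 𝔸) (y : IBondY x.toKIdx)
      (p₀ : (Fin (d + 1) × SiteY x.toKIdx) × ι), blkC x.toKIdx ιB p₀.1.2 = y → ∀ (β' Bh cζ : ℝ), 0 ≤ Bh → 0 ≤ cζ →
        (∀ (y' : IBondY x.toKIdx) (μ : (Fin (d + 1) × SiteY x.toKIdx) × ι → ℝ) (M : ℝ),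
          BlockSupp (g := toB6 (geo9Y x) (0 : ℝ) True) (fun q : (Fin (d + 1) × SiteY x.toKIdx) × ι => blkC x.toKIdx ιB q.1.2) μ y' M →
          ‖Φ ((coordEquiv b).symm (D (GbC x.toKIdx par parB b c μ)))‖ ≤
            Bh * (geo9Y x).len y ^ (1 - β') * cζ * Real.exp (-(δc * (geo9Y x).dist y y')) * M) →
        ∀ (y' : IBondY x.toKIdx) (μ : (Fin (d + 1) × SiteY x.toKIdx) × ι → ℝ) (M : ℝ),
          BlockSupp (g := toB6 (geo9Y x) (0 : ℝ) True) (fun q : (Fin (d + 1) × SiteY x.toKIdx) × ι => blkC x.toKIdx ιB q.1.2) μ y' M →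
          ‖Φ ((coordEquiv b).symm (D (GbC x.toKIdx par parB b ((codingYx G x C37 C38).bg.mul c' c) μ)))‖ ≤
            B * Bh * (geo9Y x).len y ^ (1 - β') * cζ * Real.exp (-(δc / 6 * (geo9Y x).dist y y')) * M)
    (HR : ∀ (Ds : Module.End ℝ ((Fin (d + 1) × SiteY x.toKIdx) × ι → ℝ)),
      HasMajorant (g := toB6 (geo9Y x) (0 : ℝ) True) (fun q : (Fin (d + 1) × SiteY x.toKIdx) × ι => blkC x.toKIdx ιB q.1.2)
        (GbC x.toKIdx par parB b c * Ds) (fun a a' => cRG δ * B₀ * (geo9Y x).len a * Real.exp (-(δc * (geo9Y x).dist a a'))) →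
      ∀ (Φ : (Fin (d + 1) × SiteY x.toKIdx → 𝔸) →ₗ[ℝ] 𝔸) (y : IBondY x.toKIdx) (p₀ : (Fin (d + 1) × SiteY x.toKIdx) × ι),
      blkC x.toKIdx ιB p₀.1.2 = y → ∀ (γ Bh cζ : ℝ), 0 ≤ Bh → 0 ≤ cζ →
        (∀ (y' : IBondY x.toKIdx) (μ : (Fin (d + 1) × SiteY x.toKIdx) × ι → ℝ) (M : ℝ),
          BlockSupp (g := toB6 (geo9Y x) (0 : ℝ) True) (fun q : (Fin (d + 1) × SiteY x.toKIdx) × ι => blkC x.toKIdx ιB q.1.2) μ y' M →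
          ‖Φ ((coordEquiv b).symm (GbC x.toKIdx par parB b c μ))‖ ≤
            Bh * (geo9Y x).len y ^ (2 - γ) * cζ * Real.exp (-(δc * (geo9Y x).dist y y')) * M) →
        (∀ (k : Fin (d + 1) ⊕ Fin (d + 1)) (y' : IBondY x.toKIdx) (μ : (Fin (d + 1) × SiteY x.toKIdx) × ι → ℝ) (M : ℝ),
          BlockSupp (g := toB6 (geo9Y x) (0 : ℝ) True) (fun q : (Fin (d + 1) × SiteY x.toKIdx) × ι => blkC x.toKIdx ιB q.1.2) μ y' M →
          ‖Φ ((coordEquiv b).symm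
              ((GbC x.toKIdx par parB b c * conj b (diffLetter (bT (shiftY x.toKIdx)) (bU (coordC G x.toKIdx c)) ((((geo9Y x).eta : ℂ))⁻¹) k)) μ))‖ ≤
            Bh * (geo9Y x).len y ^ (1 - γ) * cζ * Real.exp (-(δc * (geo9Y x).dist y y')) * M) →
        (∀ (y' : IBondY x.toKIdx) (μ : (Fin (d + 1) × SiteY x.toKIdx) × ι → ℝ) (M : ℝ),
          BlockSupp (g := toB6 (geo9Y x) (0 : ℝ) True) (fun q : (Fin (d + 1) × SiteY x.toKIdx) × ι => blkC x.toKIdx ιB q.1.2) μ y' M →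
          ‖Φ ((coordEquiv b).symm ((GbC x.toKIdx par parB b c * Ds) μ))‖ ≤
            Bh * (geo9Y x).len y ^ (1 - γ) * cζ * Real.exp (-(δc * (geo9Y x).dist y y')) * M) →
        ∀ (y' : IBondY x.toKIdx) (μ : (Fin (d + 1) × SiteY x.toKIdx) × ι → ℝ) (M : ℝ),
          BlockSupp (g := toB6 (geo9Y x) (0 : ℝ) True) (fun q : (Fin (d + 1) × SiteY x.toKIdx) × ι => blkC x.toKIdx ιB q.1.2) μ y' M →
          ‖Φ ((coordEquiv b).symm ((GbC x.toKIdx par parB b ((codingYx G x C37 C38).bg.mul c' c) * Ds) μ))‖ ≤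
            B * Bh * (geo9Y x).len y ^ (1 - γ) * cζ * Real.exp (-(δc / 6 * (geo9Y x).dist y y')) * M) :
    H1Block (KACU G x (GAY x.toKIdx par parB (GpY x.toKIdx par)) parB C37 C38)
      (wHG6 (2 * ((d : ℝ) + 1)) (((ℓ + 1 : ℕ) : ℝ)) (∑ j, ‖b j‖) M₂ (M₂ * ∑ j, ‖b j‖) cLip rL mN B₀ B δc Bβ) (δc / 6)
      ((codingYx G x C37 C38).bg.mul c' c) := by
  classical
  letI : Fintype (B9GeoNormsKLevelV1.geo9K x.toKIdx).Site := ‹Fintype (geo9Y x).Site›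
  -- the coded pair is (base U, mult a); the product is `prod U a`
  obtain ⟨U, a, rfl, rfl, hCa⟩ := (codingYx G x C37 C38).exists_of_bg_Cplx337 h37
  have hU335 : (bg9Y 𝔸 G x).Reg335 c35 α₀ U := by
    obtain ⟨U', h1, h2⟩ := (codingYx G x C37 C38).exists_of_bg_Reg335 hreg
    cases h1
    exact h2
  have hU : GVal G x.toKIdx U := hU335.1.1
  -- notation and elementary facts
  set Sb : ℝ := ∑ j, ‖b j‖ with hSb
  have hSb0 : 0 ≤ Sb := Finset.sum_nonneg fun j _ => norm_nonneg _
  set L : ℝ := (((ℓ + 1 : ℕ) : ℝ)) with hLdef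
  have hL1 : 1 ≤ L := by rw [hLdef]; exact_mod_cast Nat.succ_le_succ (Nat.zero_le ℓ)
  have hL0 : 0 ≤ L := le_trans zero_le_one hL1
  set OA : BondOpY 𝔸 x.toKIdx := GAY x.toKIdx par parB (GpY x.toKIdx par) with hOA
  set TU : (FBondY x.toKIdx → 𝔸) →ₗ[ℂ] (FBondY x.toKIdx → 𝔸) := OA U with hTU
  set TW : (FBondY x.toKIdx → 𝔸) →ₗ[ℂ] (FBondY x.toKIdx → 𝔸) := OA (decY x.toKIdx (.prod U a)) with hTW
  have hco : coordC G x.toKIdx (.base U) = UboxY x.toKIdx U := coordC_base_eq G x hU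
  have hη : ((((geo9Y x).eta : ℂ)))⁻¹ = ((|x.toKIdx.cf| : ℝ) : ℂ) := eta_inv_eq_abs_cf x.toKIdx
  have hDk : ∀ k : Fin (d + 1) ⊕ Fin (d + 1),
      diffLetter (bT (shiftY x.toKIdx)) (bU (coordC G x.toKIdx (.base U))) ((((geo9Y x).eta : ℂ))⁻¹) k =
        diffLetter (bT (shiftY x.toKIdx)) (bU (UboxY x.toKIdx U)) ((|x.toKIdx.cf| : ℝ) : ℂ) k := by
    intro k; rw [hco, hη]
  have hUu : ∀ (ν : Fin (d + 1)) (s : Site (PV d ℓ x.m x.K hd hL) 0),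
      ‖((U ν s : 𝔸ˣ) : 𝔸)‖ ≤ 1 ∧ ‖(((U ν s)⁻¹ : 𝔸ˣ) : 𝔸)‖ ≤ 1 := fun ν s => norm_le_one_and_inv_of_mem G hG1 (hU ν s)
  have hparU : ∀ s s' : Site (PV d ℓ x.m x.K hd hL) 0, ‖((parB U s s' : 𝔸ˣ) : 𝔸)‖ ≤ 1 ∧ ‖(((parB U s s')⁻¹ : 𝔸ˣ) : 𝔸)‖ ≤ 1 :=
    parB_contractive G x parB hG1 (hparB U hU)
  have hLipU : HolderLipBY x.toKIdx cLip rL (parB U) U := hLipB α₀ U hU335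
  have hnbrU := hnbr hM
  have hMgeo : rL + 1 < (geo9Y x).M := lt_of_lt_of_le hMr hM
  have hM1 : (1 : ℝ) < (geo9Y x).M := lt_of_le_of_lt (le_add_of_nonneg_left hrL) hMgeo
  have hdd : 0 ≤ 2 * ((d : ℝ) + 1) := by positivity
  have hdn : ∀ a a' : IBondY x.toKIdx, 0 ≤ (geo9Y x).dist a a' := fun a a' => geo9K_dist_nonneg x.toKIdx a a'
  have hk1 : 1 ≤ x.toKIdx.k := one_le_k x.toKIdx
  have htri := (B6Geom246MultiLevelTorus.triangle_refl_nonneg_T x.toKIdx.D (B9GeoLemma21KLevelV1.one_le_Mh x.toKIdx)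
    (B9GeoLemma21KLevelV1.one_le_P x.toKIdx)).1
  -- the (3.42) majorants of the bond letters at the base (def-Y's carrier, rate δ), transported to r06's carrier and lowered to the call rate δc
  have cR0 : 0 ≤ M₂ * Sb := mul_nonneg hM₂ hSb0
  have hcB : 0 ≤ M₂ * Sb * B₀ := mul_nonneg cR0 hB₀.le
  obtain ⟨g0, g1, g2, -⟩ := readG342Y_KACU (Rr := 0) (Hp := True) b G x OA parB C37 C38 ιB hι hM₂ hrepr hB₀.le hE
  have lower : ∀ (w : IBondY x.toKIdx → ℝ) (hw : ∀ a, 0 ≤ w a) {T : Module.End ℝ ((Fin (d + 1) × SiteY x.toKIdx) × ι → ℝ)},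
      HasMajorant (g := toB6 (geo9Y x) (0 : ℝ) True) (fun q : (Fin (d + 1) × SiteY x.toKIdx) × ι => blkC x.toKIdx ιB q.1.2) T
        (fun a a' => M₂ * Sb * (B₀ * w a * Real.exp (-(δ * (geo9Y x).dist a a')))) →
      HasMajorant (g := toB6 (geo9Y x) (0 : ℝ) True) (fun q : (Fin (d + 1) × SiteY x.toKIdx) × ι => blkC x.toKIdx ιB q.1.2) T
        (fun a a' => M₂ * Sb * B₀ * w a * Real.exp (-(δc * (geo9Y x).dist a a'))) := by
    intro w hw T h
    refine hasMajorant_mono _ h fun a a' => ?_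
    have hexp : Real.exp (-(δ * (geo9Y x).dist a a')) ≤ Real.exp (-(δc * (geo9Y x).dist a a')) :=
      Real.exp_le_exp.2 (by nlinarith [hdn a a'])
    calc M₂ * Sb * (B₀ * w a * Real.exp (-(δ * (geo9Y x).dist a a'))) = (M₂ * Sb * B₀ * w a) * Real.exp (-(δ * (geo9Y x).dist a a')) := by ring
      _ ≤ (M₂ * Sb * B₀ * w a) * Real.exp (-(δc * (geo9Y x).dist a a')) :=
        mul_le_mul_of_nonneg_left hexp (mul_nonneg hcB (hw a))
  have hm0 : HasMajorant (g := toB6 (geo9Y x) (0 : ℝ) True) (fun q : (Fin (d + 1) × SiteY x.toKIdx) × ι => blkC x.toKIdx ιB q.1.2)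
      (conj b (bondOpCoordsRY x.toKIdx (TU.restrictScalars ℝ)))
      (fun a a' => M₂ * Sb * B₀ * (geo9Y x).len a ^ 2 * Real.exp (-(δc * (geo9Y x).dist a a'))) :=
    lower (fun a => (geo9Y x).len a ^ 2) (fun a => sq_nonneg _) (hasMajorant_conj_bondOpCoordsRY x.toKIdx b ιB _ g0)
  have hm1 : ∀ ν : Fin (d + 1), HasMajorant (g := toB6 (geo9Y x) (0 : ℝ) True) (fun q : (Fin (d + 1) × SiteY x.toKIdx) × ι => blkC x.toKIdx ιB q.1.2)
      (conj b (bondOpCoordsRY x.toKIdx (cdBₗ x.toKIdx U ν ∘ₗ TU.restrictScalars ℝ)))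
      (fun a a' => M₂ * Sb * B₀ * (geo9Y x).len a * Real.exp (-(δc * (geo9Y x).dist a a'))) := fun ν =>
    lower (fun a => (geo9Y x).len a) (fun a => (geo9Y_len_pos x a).le) (hasMajorant_conj_bondOpCoordsRY x.toKIdx b ιB _ (g1 ν))
  have hGbU : GbC x.toKIdx par parB b (.base U) = conj b (bondOpCoordsRY x.toKIdx (TU.restrictScalars ℝ)) := by
    rw [GbC_eq_conj_bondOpCoordsRY, decY_base]
  have hm2 : ∀ ν : Fin (d + 1), HasMajorant (g := toB6 (geo9Y x) (0 : ℝ) True) (fun q : (Fin (d + 1) × SiteY x.toKIdx) × ι => blkC x.toKIdx ιB q.1.2)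
      (GbC x.toKIdx par parB b (.base U) * conj b (bondOpCoordsRY x.toKIdx (cdsBₗ x.toKIdx U ν)))
      (fun a a' => cRG δ * B₀ * (geo9Y x).len a * Real.exp (-(δc * (geo9Y x).dist a a'))) := by
    intro ν
    have h := lower (fun a => (geo9Y x).len a) (fun a => (geo9Y_len_pos x a).le) (hasMajorant_conj_bondOpCoordsRY x.toKIdx b ιB _ (g2 ν))
    have heq : conj b (bondOpCoordsRY x.toKIdx (TU.restrictScalars ℝ ∘ₗ cdsBₗ x.toKIdx U ν)) =
        GbC x.toKIdx par parB b (.base U) * conj b (bondOpCoordsRY x.toKIdx (cdsBₗ x.toKIdx U ν)) := by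
      rw [hGbU, ← B9Eq352DivFormLetters.conj_mul, ← bondOpCoordsRY_mul]; rfl
    refine hasMajorant_mono _ (hasMajorant_of_eq x.toKIdx heq.symm h) fun a a' => ?_
    have hfac : 0 ≤ B₀ * (geo9Y x).len a * Real.exp (-(δc * (geo9Y x).dist a a')) := mul_nonneg (mul_nonneg hB₀.le (geo9Y_len_pos x a).le) (Real.exp_pos _).le
    calc M₂ * Sb * B₀ * (geo9Y x).len a * Real.exp (-(δc * (geo9Y x).dist a a')) = (M₂ * Sb) * (B₀ * (geo9Y x).len a * Real.exp (-(δc * (geo9Y x).dist a a'))) := by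
          ring
      _ ≤ cRG δ * (B₀ * (geo9Y x).len a * Real.exp (-(δc * (geo9Y x).dist a a'))) := mul_le_mul_of_nonneg_right hcRG hfac
      _ = _ := by ring
  -- the output block
  intro α lam ζ y y' hα0 hα1 hζ hlam
  set W5 : ℝ := wHG6 (2 * ((d : ℝ) + 1)) L Sb M₂ (M₂ * Sb) cLip rL mN B₀ B δc Bβ α with hW5def
  have hW5 : 0 ≤ W5 := wHG6_nonneg mN Bβ hL0 hSb0 hM₂ cR0 hcLip hB₀.le hB α
  have hleny : 0 < (geo9Y x).len y := geo9Y_len_pos x y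
  have hcutH : 0 ≤ (geo9Y x).cutH α ζ := (modelSignsOn_geo9K x.toKIdx).cutH_nonneg α ζ
  have hsupN : 0 ≤ (geo9Y x).supNorm lam := (modelSignsOn_geo9K x.toKIdx).supNorm_nonneg lam
  have hRHS : 0 ≤ W5 * (geo9Y x).len y ^ (1 - α) * (geo9Y x).cutH α ζ * Real.exp (-(δc / 6 * (geo9Y x).dist y y')) * (geo9Y x).supNorm lam :=
    mul_nonneg (mul_nonneg (mul_nonneg (mul_nonneg hW5 (Real.rpow_nonneg hleny.le _)) hcutH) (Real.exp_pos _).le) hsupN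
  -- only (bond argument, bond cut-off) is nontrivial
  rcases lam with f | J
  · rw [(KACU_h1_off G x OA parB C37 C38 _ α).2 f ζ]; exact hRHS
  rcases ζ with zs | z
  · rw [(KACU_h1_off G x OA parB C37 C38 _ α).1 J zs]; exact hRHS
  -- the U-letter reading of `G(U′U)` at the base `U`
  rw [KACU_h1_inr_eq]
  show h1ReadB x.toKIdx TW (parB U) U J α z ≤ _
  have hζ' : ∀ q, z q ≠ 0 → (geomT x.toKIdx.D).dist (blkV1 x.toKIdx.hN x.toKIdx.D q) (β x.toKIdx.hN x.toKIdx.D x.toKIdx.hk y) ≤ 1 := hζ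
  -- the anchor: the labelled block of `y`, through a site `w₀` of the block `βy`
  obtain ⟨w₀, hw₀⟩ := B6Geom246MultiLevelBox.exists_blkOf_eq x.toKIdx.D.toDomains (β x.toKIdx.hN x.toKIdx.D x.toKIdx.hk y)
  set y₁ : IBondY x.toKIdx := blkC x.toKIdx ιB w₀ with hy₁
  have hy₁' : y₁ = ιB (β x.toKIdx.hN x.toKIdx.D x.toKIdx.hk y) := by rw [hy₁]; show ιB (B9Eq360DeltaPrimeAY.blkY x.toKIdx w₀) = _; rw [← hw₀]; rfl
  have hy₁β : β x.toKIdx.hN x.toKIdx.D x.toKIdx.hk y₁ = β x.toKIdx.hN x.toKIdx.D x.toKIdx.hk y := by rw [hy₁', hι]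
  have hlen : (geo9Y x).len y₁ = (geo9Y x).len y := Node00.OpsYRead342.geo9K_len_congr x.toKIdx hy₁β
  have hdist : ∀ t : IBondY x.toKIdx, (geo9Y x).dist y₁ t = (geo9Y x).dist y t := fun t => Node00.OpsYRead342.geo9K_dist_congr x.toKIdx hy₁β rfl
  set yL : IBondY x.toKIdx := ιB (β x.toKIdx.hN x.toKIdx.D x.toKIdx.hk y') with hyL
  have hdistL : (geo9Y x).dist y₁ yL = (geo9Y x).dist y y' := Node00.OpsYRead342.geo9K_dist_congr x.toKIdx hy₁β (hι _)
  have hleny₁ : 0 < (geo9Y x).len y₁ := geo9Y_len_pos x y₁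
  haveI : Nontrivial 𝔸 := NormOneClass.nontrivial
  obtain ⟨j₀⟩ := b.index_nonempty
  have hp₀ : blkC x.toKIdx ιB ((((0 : Fin (d + 1)), w₀), j₀) : (Fin (d + 1) × SiteY x.toKIdx) × ι).1.2 = y₁ := rfl
  -- geometry near the anchor: blocks within `< M` of `βy` have comparable lengths and shifted decay
  have hnear : ∀ (q : FBondY x.toKIdx) (r : ℝ), (geomT x.toKIdx.D).dist (blkV1 x.toKIdx.hN x.toKIdx.D q) (β x.toKIdx.hN x.toKIdx.D x.toKIdx.hk y) ≤ r →
      r < (geo9Y x).M →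
      (geo9Y x).len (ιB (blkV1 x.toKIdx.hN x.toKIdx.D q)) ≤ L * (geo9Y x).len y₁ ∧
      (geo9Y x).len y₁ ≤ L * (geo9Y x).len (ιB (blkV1 x.toKIdx.hN x.toKIdx.D q)) ∧
      ∀ y'' : IBondY x.toKIdx, Real.exp (-(δc * (geo9Y x).dist (ιB (blkV1 x.toKIdx.hN x.toKIdx.D q)) y'')) ≤
        Real.exp (δc * r) * Real.exp (-(δc * (geo9Y x).dist y₁ y'')) := by
    intro q r hq hr
    have hdq : (geo9Y x).dist (ιB (blkV1 x.toKIdx.hN x.toKIdx.D q)) y₁ = (geomT x.toKIdx.D).dist (blkV1 x.toKIdx.hN x.toKIdx.D q) (β x.toKIdx.hN x.toKIdx.D x.toKIdx.hk y) := by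
      show (geomT x.toKIdx.D).dist (β x.toKIdx.hN x.toKIdx.D x.toKIdx.hk (ιB _)) (β x.toKIdx.hN x.toKIdx.D x.toKIdx.hk y₁) = _
      rw [hι, hy₁β]
    have hlt : (geo9Y x).dist (ιB (blkV1 x.toKIdx.hN x.toKIdx.D q)) y₁ < (geo9Y x).M := by rw [hdq]; exact lt_of_le_of_lt hq hr
    have hlt' : (geo9Y x).dist y₁ (ιB (blkV1 x.toKIdx.hN x.toKIdx.D q)) < (geo9Y x).M := by rw [geo9Y_dist_comm]; exact hlt
    refine ⟨len_le_of_dist_lt_M_geo9K x.toKIdx hlt, len_le_of_dist_lt_M_geo9K x.toKIdx hlt', fun y'' => ?_⟩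
    rw [← Real.exp_add]
    refine Real.exp_le_exp.2 ?_
    have ht := geo9Y_dist_triangle x y₁ (ιB (blkV1 x.toKIdx.hN x.toKIdx.D q)) y''
    rw [geo9Y_dist_comm x y₁ (ιB _), hdq] at ht
    nlinarith [hdn (ιB (blkV1 x.toKIdx.hN x.toKIdx.D q)) y'']
  -- constants
  set cζ : ℝ := (geo9Y x).cutH α (Sum.inr z) with hcζ
  have hcζ0 : 0 ≤ cζ := hcutH
  set Bp : ℝ := max (Bβ α) 0 with hBp
  have hBp0 : 0 ≤ Bp := le_max_right _ _
  set BhL : ℝ := Sb * Bp with hBhL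
  have hBhL0 : 0 ≤ BhL := mul_nonneg hSb0 hBp0
  set BhA : ℝ := Sb * (M₂ * Sb * B₀) * (L ^ 3 * Real.exp δc + cLip * L ^ 2 * Real.exp (δc * (rL + 1))) with hBhA
  have hBhA0 : 0 ≤ BhA := by positivity
  set BhX : ℝ := Sb * Bp * (1 + (mN : ℝ) * (M₂ * Sb) * Real.exp (δc * (2 * ((d : ℝ) + 1)))) with hBhX
  have hBhX0 : 0 ≤ BhX := by positivity
  set BhR : ℝ := BhX + BhA with hBhR
  have hBhR0 : 0 ≤ BhR := add_nonneg hBhX0 hBhA0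
  -- the (3.43) block at the base, READ: reading bounds for scalar inputs supported in a block, at the call rate δc
  set Wf : IBondY x.toKIdx → ℝ := fun a' => Bp * (geo9Y x).len y₁ ^ (1 - α) * cζ * Real.exp (-(δc * (geo9Y x).dist y₁ a')) with hWf
  have hWf0 : ∀ a', 0 ≤ Wf a' := fun a' =>
    mul_nonneg (mul_nonneg (mul_nonneg hBp0 (Real.rpow_nonneg hleny₁.le _)) hcζ0) (Real.exp_pos _).le
  have hreadU : ∀ (g : FBondY x.toKIdx → ℝ) (a' : IBondY x.toKIdx), (geo9Y x).suppIn (Sum.inr g) a' →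
      h1ReadB x.toKIdx TU (parB U) U g α z ≤ Wf a' * (geo9Y x).supNorm (Sum.inr g) := by
    intro g a' hg
    have h := hH1 α (Sum.inr g) (Sum.inr z) y a' hα0 hα1 hζ hg
    rw [KACU_h1_inr_eq] at h
    have hN : 0 ≤ (geo9Y x).supNorm (Sum.inr g) := (modelSignsOn_geo9K x.toKIdx).supNorm_nonneg _
    refine (show h1ReadB x.toKIdx TU (parB U) U g α z ≤ _ from h).trans ?_
    rw [← hlen, ← hdist]
    have hP : 0 ≤ (geo9Y x).len y₁ ^ (1 - α) * cζ := mul_nonneg (Real.rpow_nonneg hleny₁.le _) hcζ0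
    have hexp : Real.exp (-(δ * (geo9Y x).dist y₁ a')) ≤ Real.exp (-(δc * (geo9Y x).dist y₁ a')) :=
      Real.exp_le_exp.2 (by nlinarith [hdn y₁ a'])
    calc Bβ α * (geo9Y x).len y₁ ^ (1 - α) * (geo9Y x).cutH α (Sum.inr z) * Real.exp (-(δ * (geo9Y x).dist y₁ a')) *
          (geo9Y x).supNorm (Sum.inr g)
        = Bβ α * (((geo9Y x).len y₁ ^ (1 - α) * cζ) * Real.exp (-(δ * (geo9Y x).dist y₁ a')) * (geo9Y x).supNorm (Sum.inr g)) := by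
          rw [hcζ]; ring
      _ ≤ Bp * (((geo9Y x).len y₁ ^ (1 - α) * cζ) * Real.exp (-(δc * (geo9Y x).dist y₁ a')) * (geo9Y x).supNorm (Sum.inr g)) := by
          refine mul_le_mul (le_max_left _ _) ?_ (mul_nonneg (mul_nonneg hP (Real.exp_pos _).le) hN) hBp0
          exact mul_le_mul_of_nonneg_right (mul_le_mul_of_nonneg_left hexp hP) hN
      _ = Wf a' * (geo9Y x).supNorm (Sum.inr g) := by rw [hWf]; ring
  -- the block support of the coordinates of the output input `J ⊗ E`
  have hBS : ∀ {E : 𝔸}, ‖E‖ ≤ 1 → BlockSupp (g := toB6 (geo9Y x) (0 : ℝ) True) (fun q : (Fin (d + 1) × SiteY x.toKIdx) × ι => blkC x.toKIdx ιB q.1.2)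
      (coordEquiv b (bondFunCoordsY x.toKIdx (liftY J E))) yL (M₂ * (geo9Y x).supNorm (Sum.inr J)) := fun hE1 =>
    blockSupp_coordEquiv_bondFun_liftY x.toKIdx b ιB hM₂ hrepr J y' hlam hE1
  ------------------------------------------------------------------
  -- LEFT WORDS: `∇_{U,ν}G(U′U)(J ⊗ E)`
  ------------------------------------------------------------------
  have hLeft : ∀ (E : BallY 𝔸) (ν : Fin (d + 1)) (q q' : FBondY x.toKIdx), Adm x.toKIdx q q' →
      ‖probeB x.toKIdx (parB U) α z q q' (cdB x.toKIdx U ν (TW (liftY J (E : 𝔸))))‖ ≤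
        B * BhL * (geo9Y x).len y₁ ^ (1 - α) * cζ * Real.exp (-(δc / 6 * (geo9Y x).dist y₁ yL)) * (M₂ * (geo9Y x).supNorm (Sum.inr J)) := by
    intro E ν q q' hadm
    have hE1 : ‖(E : 𝔸)‖ ≤ 1 := mem_closedBall_zero_iff.1 E.2
    set D : Module.End ℝ ((Fin (d + 1) × SiteY x.toKIdx) × ι → ℝ) := conj b (bondOpCoordsRY x.toKIdx (cdBₗ x.toKIdx U ν)) with hD
    set Φ : (Fin (d + 1) × SiteY x.toKIdx → 𝔸) →ₗ[ℝ] 𝔸 := probeBC x.toKIdx (parB U) α z q q' with hΦ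
    -- the premise at the base
    have prem : ∀ (y'' : IBondY x.toKIdx) (μ : (Fin (d + 1) × SiteY x.toKIdx) × ι → ℝ) (M : ℝ),
        BlockSupp (g := toB6 (geo9Y x) (0 : ℝ) True) (fun q : (Fin (d + 1) × SiteY x.toKIdx) × ι => blkC x.toKIdx ιB q.1.2) μ y'' M →
        ‖Φ ((coordEquiv b).symm (D (GbC x.toKIdx par parB b (.base U) μ)))‖ ≤
          BhL * (geo9Y x).len y₁ ^ (1 - α) * cζ * Real.exp (-(δc * (geo9Y x).dist y₁ y'')) * M := by
      intro y'' μ M hμ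
      calc ‖Φ ((coordEquiv b).symm (D (GbC x.toKIdx par parB b (.base U) μ)))‖
          = ‖probeB x.toKIdx (parB U) α z q q' (cdB x.toKIdx U ν (TU (lamB x.toKIdx b μ)))‖ := by
            rw [hΦ, probeBC_symm, ← Module.End.mul_apply, hD, lamB_DL_GbC, decY_base]
        _ ≤ Sb * (Wf y'' * M) := probeL_lamB_le x.toKIdx b ιB TU (parB U) U hι hM₂ hrepr α z hWf0 hreadU hμ ν hadm
        _ = BhL * (geo9Y x).len y₁ ^ (1 - α) * cζ * Real.exp (-(δc * (geo9Y x).dist y₁ y'')) * M := by rw [hWf, hBhL]; ring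
    have concl := HL D Φ y₁ _ hp₀ α BhL cζ hBhL0 hcζ0 prem yL (coordEquiv b (bondFunCoordsY x.toKIdx (liftY J (E : 𝔸)))) _ (hBS hE1)
    calc ‖probeB x.toKIdx (parB U) α z q q' (cdB x.toKIdx U ν (TW (liftY J (E : 𝔸))))‖
        = ‖Φ ((coordEquiv b).symm (D (GbC x.toKIdx par parB b ((codingYx G x C37 C38).bg.mul (.mult a) (.base U))
            (coordEquiv b (bondFunCoordsY x.toKIdx (liftY J (E : 𝔸)))))))‖ := by
          rw [hΦ, probeBC_symm, ← Module.End.mul_apply, hD, lamB_DL_GbC, lamB_coordEquiv_bondFunCoordsY]; rfl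
      _ ≤ _ := concl
  ------------------------------------------------------------------
  -- RIGHT WORDS: `G(U′U)∇*_{U,ν}(J ⊗ E)`
  ------------------------------------------------------------------
  have hRight : ∀ (E : BallY 𝔸) (ν : Fin (d + 1)) (q q' : FBondY x.toKIdx), Adm x.toKIdx q q' →
      ‖probeB x.toKIdx (parB U) α z q q' (TW (cdsB x.toKIdx U ν (liftY J (E : 𝔸))))‖ ≤
        B * BhR * (geo9Y x).len y₁ ^ (1 - α) * cζ * Real.exp (-(δc / 6 * (geo9Y x).dist y₁ yL)) * (M₂ * (geo9Y x).supNorm (Sum.inr J)) := by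
    intro E ν q q' hadm
    have hE1 : ‖(E : 𝔸)‖ ≤ 1 := mem_closedBall_zero_iff.1 E.2
    set Ds : Module.End ℝ ((Fin (d + 1) × SiteY x.toKIdx) × ι → ℝ) := conj b (bondOpCoordsRY x.toKIdx (cdsBₗ x.toKIdx U ν)) with hDs
    set Φ : (Fin (d + 1) × SiteY x.toKIdx → 𝔸) →ₗ[ℝ] 𝔸 := probeBC x.toKIdx (parB U) α z q q' with hΦ
    have hfac1 : ∀ (y'' : IBondY x.toKIdx) (M : ℝ), 0 ≤ M → 0 ≤ (geo9Y x).len y₁ ^ (1 - α) * cζ * Real.exp (-(δc * (geo9Y x).dist y₁ y'')) * M :=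
      fun y'' M hM => mul_nonneg (mul_nonneg (mul_nonneg (Real.rpow_nonneg hleny₁.le _) hcζ0) (Real.exp_pos _).le) hM
    -- (1) the right-word premise at a backward letter (shared by (b′)-inr and (c′))
    have hbinr : ∀ (ν' : Fin (d + 1)) (y'' : IBondY x.toKIdx) (μ : (Fin (d + 1) × SiteY x.toKIdx) × ι → ℝ) (M : ℝ),
        BlockSupp (g := toB6 (geo9Y x) (0 : ℝ) True) (fun q : (Fin (d + 1) × SiteY x.toKIdx) × ι => blkC x.toKIdx ιB q.1.2) μ y'' M →
        ‖Φ ((coordEquiv b).symm ((GbC x.toKIdx par parB b (.base U) * conj b (bondOpCoordsRY x.toKIdx (cdsBₗ x.toKIdx U ν'))) μ))‖ ≤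
          BhR * (geo9Y x).len y₁ ^ (1 - α) * cζ * Real.exp (-(δc * (geo9Y x).dist y₁ y'')) * M := by
      intro ν' y'' μ M hμ
      calc ‖Φ ((coordEquiv b).symm ((GbC x.toKIdx par parB b (.base U) * conj b (bondOpCoordsRY x.toKIdx (cdsBₗ x.toKIdx U ν'))) μ))‖
          = ‖probeB x.toKIdx (parB U) α z q q' (TU (cdsB x.toKIdx U ν' (lamB x.toKIdx b μ)))‖ := by
            rw [hΦ, probeBC_symm, lamB_GbC_DR, decY_base]
        _ ≤ Sb * (Wf y'' * M) := probeR_lamB_le x.toKIdx b ιB TU (parB U) U hι hM₂ hrepr α z hWf0 hreadU hμ ν' hadm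
        _ = (Sb * Bp) * ((geo9Y x).len y₁ ^ (1 - α) * cζ * Real.exp (-(δc * (geo9Y x).dist y₁ y'')) * M) := by rw [hWf]; ring
        _ ≤ BhR * ((geo9Y x).len y₁ ^ (1 - α) * cζ * Real.exp (-(δc * (geo9Y x).dist y₁ y'')) * M) := by
            refine mul_le_mul_of_nonneg_right ?_ (hfac1 y'' M hμ.nonneg)
            rw [hBhR, hBhX]
            have h2 : Sb * Bp ≤ Sb * Bp * (1 + (mN : ℝ) * (M₂ * Sb) * Real.exp (δc * (2 * ((d : ℝ) + 1)))) :=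
              le_mul_of_one_le_right hBhL0 (le_add_of_nonneg_right (by positivity))
            linarith
        _ = BhR * (geo9Y x).len y₁ ^ (1 - α) * cζ * Real.exp (-(δc * (geo9Y x).dist y₁ y'')) * M := by ring
    -- (2) premise (a′): the undifferentiated probe (`probeB_undiff_le` with the (3.42) majorants, the law and the level comparability)
    have prema : ∀ (y'' : IBondY x.toKIdx) (μ : (Fin (d + 1) × SiteY x.toKIdx) × ι → ℝ) (M : ℝ),
        BlockSupp (g := toB6 (geo9Y x) (0 : ℝ) True) (fun q : (Fin (d + 1) × SiteY x.toKIdx) × ι => blkC x.toKIdx ιB q.1.2) μ y'' M →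
        ‖Φ ((coordEquiv b).symm (GbC x.toKIdx par parB b (.base U) μ))‖ ≤
          BhR * (geo9Y x).len y₁ ^ (2 - α) * cζ * Real.exp (-(δc * (geo9Y x).dist y₁ y'')) * M := by
      intro y'' μ M hμ
      have hM0 : 0 ≤ M := hμ.nonneg
      set Ed : ℝ := Real.exp (-(δc * (geo9Y x).dist y₁ y'')) with hEd
      have hEd0 : 0 < Ed := Real.exp_pos _
      set Ψ : FBondY x.toKIdx → 𝔸 := TU (lamB x.toKIdx b μ) with hΨ
      -- values of Ψ and of its covariant differences near `βy`
      set A₀ : ℝ := Sb * (M₂ * Sb * B₀ * (L * (geo9Y x).len y₁) ^ 2 * (Real.exp (δc * 1) * Ed) * M) with hA₀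
      have hA₀0 : 0 ≤ A₀ := by positivity
      set A₁ : ℝ := Sb * (M₂ * Sb * B₀ * (L * (geo9Y x).len y₁) * (Real.exp (δc * (rL + 1)) * Ed) * M) with hA₁
      have hA₁0 : 0 ≤ A₁ := by positivity
      have h0 : ∀ q' : FBondY x.toKIdx, (geomT x.toKIdx.D).dist (blkV1 x.toKIdx.hN x.toKIdx.D q') (β x.toKIdx.hN x.toKIdx.D x.toKIdx.hk y) ≤ 1 → ‖Ψ q'‖ ≤ A₀ := by
        intro q' hq'
        obtain ⟨hl1, -, hex⟩ := hnear q' 1 hq' hM1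
        have hv := norm_lamB_le_of_hasMajorant x.toKIdx b ιB hm0 hμ q'
        rw [lamB_conj_bondOpCoordsRY] at hv
        refine (show ‖Ψ q'‖ ≤ _ from hv).trans ?_
        rw [hA₀]
        refine mul_le_mul_of_nonneg_left ?_ hSb0
        have hl2 : (geo9Y x).len (ιB (blkV1 x.toKIdx.hN x.toKIdx.D q')) ^ 2 ≤ (L * (geo9Y x).len y₁) ^ 2 :=
          pow_le_pow_left₀ (geo9Y_len_pos x _).le hl1 2
        have hstep : M₂ * Sb * B₀ * (geo9Y x).len (ιB (blkV1 x.toKIdx.hN x.toKIdx.D q')) ^ 2 *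
              Real.exp (-(δc * (geo9Y x).dist (ιB (blkV1 x.toKIdx.hN x.toKIdx.D q')) y'')) * M
            ≤ M₂ * Sb * B₀ * (L * (geo9Y x).len y₁) ^ 2 * (Real.exp (δc * 1) * Ed) * M :=
          mul_le_mul (mul_le_mul (mul_le_mul_of_nonneg_left hl2 hcB) (hex y'') (Real.exp_pos _).le (by positivity)) le_rfl hM0 (by positivity)
        exact hstep
      have h1 : ∀ (q' : FBondY x.toKIdx) (μ' : Fin (d + 1)),
          (geomT x.toKIdx.D).dist (blkV1 x.toKIdx.hN x.toKIdx.D q') (β x.toKIdx.hN x.toKIdx.D x.toKIdx.hk y) ≤ rL + 1 → ‖cdB x.toKIdx U μ' Ψ q'‖ ≤ A₁ := by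
        intro q' μ' hq'
        obtain ⟨hl1, -, hex⟩ := hnear q' (rL + 1) hq' hMgeo
        have hv := norm_lamB_le_of_hasMajorant x.toKIdx b ιB (hm1 μ') hμ q'
        rw [lamB_conj_bondOpCoordsRY] at hv
        refine (show ‖cdB x.toKIdx U μ' Ψ q'‖ ≤ _ from hv).trans ?_
        rw [hA₁]
        refine mul_le_mul_of_nonneg_left ?_ hSb0
        have hstep : M₂ * Sb * B₀ * (geo9Y x).len (ιB (blkV1 x.toKIdx.hN x.toKIdx.D q')) *
              Real.exp (-(δc * (geo9Y x).dist (ιB (blkV1 x.toKIdx.hN x.toKIdx.D q')) y'')) * M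
            ≤ M₂ * Sb * B₀ * (L * (geo9Y x).len y₁) * (Real.exp (δc * (rL + 1)) * Ed) * M :=
          mul_le_mul (mul_le_mul (mul_le_mul_of_nonneg_left hl1 hcB) (hex y'') (Real.exp_pos _).le (by positivity)) le_rfl hM0 (by positivity)
        exact hstep
      -- the scale lengths of the blocks within 1 of `βy`
      have hlenq : ∀ q' : FBondY x.toKIdx, (geo9Y x).len (ιB (blkV1 x.toKIdx.hN x.toKIdx.D q')) = lenB x.toKIdx q' := by
        intro q'
        show (kGeo x.toKIdx).len (ιB (blkV1 x.toKIdx.hN x.toKIdx.D q')) = _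
        rw [B6KLevelCensusIndexV1.len_eq, ← beta_level x.toKIdx.hN x.toKIdx.D x.toKIdx.hk hk1, div_eq_mul_inv, hι]
        rfl
      have hlo : ∀ q' : FBondY x.toKIdx, (geomT x.toKIdx.D).dist (blkV1 x.toKIdx.hN x.toKIdx.D q') (β x.toKIdx.hN x.toKIdx.D x.toKIdx.hk y) ≤ 1 →
          (geo9Y x).len y₁ / L ≤ lenB x.toKIdx q' := by
        intro q' hq'
        obtain ⟨-, hl2, -⟩ := hnear q' 1 hq' hM1
        rw [← hlenq, div_le_iff₀ (lt_of_lt_of_le one_pos hL1)]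
        linarith
      have hhi : ∀ q' : FBondY x.toKIdx, (geomT x.toKIdx.D).dist (blkV1 x.toKIdx.hN x.toKIdx.D q') (β x.toKIdx.hN x.toKIdx.D x.toKIdx.hk y) ≤ 1 →
          lenB x.toKIdx q' ≤ L * (geo9Y x).len y₁ := by
        intro q' hq'
        obtain ⟨hl1, -, -⟩ := hnear q' 1 hq' hM1
        rw [← hlenq]; exact hl1
      have hLam0 : 0 < (geo9Y x).len y₁ / L := div_pos hleny₁ (lt_of_lt_of_le one_pos hL1)
      have hLam1 : 0 ≤ L * (geo9Y x).len y₁ := mul_nonneg hL0 hleny₁.le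
      have hu := probeB_undiff_le x.toKIdx (parB U) U hcLip hLipU hparU hα0 hα1.le z y hζ' Ψ hA₀0 hA₁0 hLam0 hLam1 h0 h1 hlo hhi hadm
      have hbr : ‖Φ ((coordEquiv b).symm (GbC x.toKIdx par parB b (.base U) μ))‖ = ‖probeB x.toKIdx (parB U) α z q q' Ψ‖ := by
        rw [hΦ, probeBC_symm, lamB_GbC, decY_base]
      rw [hbr]
      refine hu.trans ?_
      -- arithmetic: `cζ·(Λ₀^{−α}A₀ + c_Lip Λ₁^{1−α} A₁) ≦ B_hA·ℓ^{2−α}·cζ·E″·M ≦ B_hR·…`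
      have hP1 : ((geo9Y x).len y₁ / L) ^ (-α) * A₀ ≤ Sb * (M₂ * Sb * B₀) * (L ^ 3 * Real.exp δc) * ((geo9Y x).len y₁ ^ (2 - α) * Ed * M) := by
        have hr := div_rpow_neg_mul_sq_le hleny₁ hL1 hα1.le
        have hq : 0 ≤ Sb * (M₂ * Sb * B₀) * L ^ 2 * (Real.exp (δc * 1) * Ed) * M := by positivity
        calc ((geo9Y x).len y₁ / L) ^ (-α) * A₀
            = (((geo9Y x).len y₁ / L) ^ (-α) * (geo9Y x).len y₁ ^ 2) * (Sb * (M₂ * Sb * B₀) * L ^ 2 * (Real.exp (δc * 1) * Ed) * M) := by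
              rw [hA₀]; ring
          _ ≤ (L * (geo9Y x).len y₁ ^ (2 - α)) * (Sb * (M₂ * Sb * B₀) * L ^ 2 * (Real.exp (δc * 1) * Ed) * M) :=
              mul_le_mul_of_nonneg_right hr hq
          _ = Sb * (M₂ * Sb * B₀) * (L ^ 3 * Real.exp δc) * ((geo9Y x).len y₁ ^ (2 - α) * Ed * M) := by rw [mul_one]; ring
      have hP2 : cLip * (L * (geo9Y x).len y₁) ^ (1 - α) * A₁ ≤
          Sb * (M₂ * Sb * B₀) * (cLip * L ^ 2 * Real.exp (δc * (rL + 1))) * ((geo9Y x).len y₁ ^ (2 - α) * Ed * M) := by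
        have hr := mul_rpow_mul_le hleny₁ hL1 hα0
        have hq : 0 ≤ cLip * (Sb * (M₂ * Sb * B₀) * L * (Real.exp (δc * (rL + 1)) * Ed) * M) := by positivity
        calc cLip * (L * (geo9Y x).len y₁) ^ (1 - α) * A₁
            = ((L * (geo9Y x).len y₁) ^ (1 - α) * (geo9Y x).len y₁) * (cLip * (Sb * (M₂ * Sb * B₀) * L * (Real.exp (δc * (rL + 1)) * Ed) * M)) := by
              rw [hA₁]; ring
          _ ≤ (L * (geo9Y x).len y₁ ^ (2 - α)) * (cLip * (Sb * (M₂ * Sb * B₀) * L * (Real.exp (δc * (rL + 1)) * Ed) * M)) :=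
              mul_le_mul_of_nonneg_right hr hq
          _ = Sb * (M₂ * Sb * B₀) * (cLip * L ^ 2 * Real.exp (δc * (rL + 1))) * ((geo9Y x).len y₁ ^ (2 - α) * Ed * M) := by ring
      have hfac2 : 0 ≤ (geo9Y x).len y₁ ^ (2 - α) * Ed * M := mul_nonneg (mul_nonneg (Real.rpow_nonneg hleny₁.le _) hEd0.le) hM0
      have hAle : BhA ≤ BhR := by rw [hBhR]; exact le_add_of_nonneg_left hBhX0
      calc (geo9Y x).cutH α (Sum.inr z) * (((geo9Y x).len y₁ / L) ^ (-α) * A₀ + cLip * (L * (geo9Y x).len y₁) ^ (1 - α) * A₁)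
          ≤ cζ * (Sb * (M₂ * Sb * B₀) * (L ^ 3 * Real.exp δc) * ((geo9Y x).len y₁ ^ (2 - α) * Ed * M) +
              Sb * (M₂ * Sb * B₀) * (cLip * L ^ 2 * Real.exp (δc * (rL + 1))) * ((geo9Y x).len y₁ ^ (2 - α) * Ed * M)) := by
            rw [← hcζ]; exact mul_le_mul_of_nonneg_left (add_le_add hP1 hP2) hcζ0
        _ = BhA * ((geo9Y x).len y₁ ^ (2 - α) * cζ * Ed * M) := by rw [hBhA]; ring
        _ ≤ BhR * ((geo9Y x).len y₁ ^ (2 - α) * cζ * Ed * M) :=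
            mul_le_mul_of_nonneg_right hAle (mul_nonneg (mul_nonneg (mul_nonneg (Real.rpow_nonneg hleny₁.le _) hcζ0) hEd0.le) hM0)
        _ = BhR * (geo9Y x).len y₁ ^ (2 - α) * cζ * Real.exp (-(δc * (geo9Y x).dist y₁ y'')) * M := by rw [hEd]; ring
    -- (3) premise (b′): every letter `∇♯_k` on the right of `G(U)` (forward letters through the CROSS read)
    have premb : ∀ (k : Fin (d + 1) ⊕ Fin (d + 1)) (y'' : IBondY x.toKIdx) (μ : (Fin (d + 1) × SiteY x.toKIdx) × ι → ℝ) (M : ℝ),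
        BlockSupp (g := toB6 (geo9Y x) (0 : ℝ) True) (fun q : (Fin (d + 1) × SiteY x.toKIdx) × ι => blkC x.toKIdx ιB q.1.2) μ y'' M →
        ‖Φ ((coordEquiv b).symm ((GbC x.toKIdx par parB b (.base U) *
            conj b (diffLetter (bT (shiftY x.toKIdx)) (bU (coordC G x.toKIdx (.base U))) ((((geo9Y x).eta : ℂ))⁻¹) k)) μ))‖ ≤
          BhR * (geo9Y x).len y₁ ^ (1 - α) * cζ * Real.exp (-(δc * (geo9Y x).dist y₁ y'')) * M := by
      intro k y'' μ M hμ
      rcases k with ν' | ν'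
      · -- forward letter: the cross word
        rw [hDk, norm_map_symm_mul_diffLetter_inl, hΦ, probeBC_symm, lamB_GbC_DF, decY_base]
        set W₀ : ℝ := Bp * (geo9Y x).len y₁ ^ (1 - α) * cζ * (Real.exp (δc * (2 * ((d : ℝ) + 1))) * Real.exp (-(δc * (geo9Y x).dist y₁ y''))) with hW₀
        have hWnbr : ∀ a' ∈ nbr (geo9Y x) (2 * ((d : ℝ) + 1)) y'', Wf a' ≤ W₀ := by
          intro a' ha'
          have hda : (geo9Y x).dist a' y'' ≤ 2 * ((d : ℝ) + 1) := mem_nbr.1 ha'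
          have htri' := geo9Y_dist_triangle x y₁ a' y''
          rw [hWf, hW₀]
          refine mul_le_mul_of_nonneg_left ?_ (mul_nonneg (mul_nonneg hBp0 (Real.rpow_nonneg hleny₁.le _)) hcζ0)
          rw [← Real.exp_add]
          exact Real.exp_le_exp.2 (by nlinarith)
        have h := probe_crossB_lamB_le x.toKIdx b ιB TU (parB U) U hι hM₂ hrepr hUu hnbrU α z y'' hWf0 hWnbr hreadU μ hμ ν' hadm
        refine h.trans ?_
        have hle : Sb * (((mN : ℝ) * (M₂ * Sb) * W₀) * M) = (Sb * Bp * ((mN : ℝ) * (M₂ * Sb) * Real.exp (δc * (2 * ((d : ℝ) + 1))))) *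
            ((geo9Y x).len y₁ ^ (1 - α) * cζ * Real.exp (-(δc * (geo9Y x).dist y₁ y'')) * M) := by rw [hW₀]; ring
        rw [hle]
        have hco2 : Sb * Bp * ((mN : ℝ) * (M₂ * Sb) * Real.exp (δc * (2 * ((d : ℝ) + 1)))) ≤ BhR := by
          rw [hBhR, hBhX]
          have : Sb * Bp * ((mN : ℝ) * (M₂ * Sb) * Real.exp (δc * (2 * ((d : ℝ) + 1)))) ≤
              Sb * Bp * (1 + (mN : ℝ) * (M₂ * Sb) * Real.exp (δc * (2 * ((d : ℝ) + 1)))) :=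
            mul_le_mul_of_nonneg_left (le_add_of_nonneg_left zero_le_one) hBhL0
          linarith
        calc (Sb * Bp * ((mN : ℝ) * (M₂ * Sb) * Real.exp (δc * (2 * ((d : ℝ) + 1))))) *
              ((geo9Y x).len y₁ ^ (1 - α) * cζ * Real.exp (-(δc * (geo9Y x).dist y₁ y'')) * M)
            ≤ BhR * ((geo9Y x).len y₁ ^ (1 - α) * cζ * Real.exp (-(δc * (geo9Y x).dist y₁ y'')) * M) :=
              mul_le_mul_of_nonneg_right hco2 (hfac1 y'' M hμ.nonneg)
          _ = _ := by ring
      · -- backward letter: the printed right word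
        rw [hDk, norm_map_symm_mul_diffLetter_inr]
        exact hbinr ν' y'' μ M hμ
    -- (4) premise (c′) and the conclusion of the right transfer
    have concl := HR Ds (hm2 ν) Φ y₁ _ hp₀ α BhR cζ hBhR0 hcζ0 prema premb (fun y'' μ M hμ => by rw [hDs]; exact hbinr ν y'' μ M hμ)
      yL (coordEquiv b (bondFunCoordsY x.toKIdx (liftY J (E : 𝔸)))) _ (hBS hE1)
    calc ‖probeB x.toKIdx (parB U) α z q q' (TW (cdsB x.toKIdx U ν (liftY J (E : 𝔸))))‖
        = ‖Φ ((coordEquiv b).symm ((GbC x.toKIdx par parB b ((codingYx G x C37 C38).bg.mul (.mult a) (.base U)) * Ds)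
            (coordEquiv b (bondFunCoordsY x.toKIdx (liftY J (E : 𝔸))))))‖ := by
          rw [hΦ, probeBC_symm, hDs, lamB_GbC_DR, lamB_coordEquiv_bondFunCoordsY]; rfl
      _ ≤ _ := concl
  ------------------------------------------------------------------
  -- WRITE the (3.43) block of the reading at the product
  ------------------------------------------------------------------
  have hfacN : 0 ≤ (geo9Y x).len y ^ (1 - α) * cζ * Real.exp (-(δc / 6 * (geo9Y x).dist y y')) * (geo9Y x).supNorm (Sum.inr J) :=
    mul_nonneg (mul_nonneg (mul_nonneg (Real.rpow_nonneg hleny.le _) hcζ0) (Real.exp_pos _).le) hsupN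
  have hfinal : ∀ {Bh : ℝ}, 0 ≤ Bh → M₂ * (B * Bh) ≤ W5 →
      B * Bh * (geo9Y x).len y₁ ^ (1 - α) * cζ * Real.exp (-(δc / 6 * (geo9Y x).dist y₁ yL)) * (M₂ * (geo9Y x).supNorm (Sum.inr J)) ≤
        W5 * (geo9Y x).len y ^ (1 - α) * (geo9Y x).cutH α (Sum.inr z) * Real.exp (-(δc / 6 * (geo9Y x).dist y y')) * (geo9Y x).supNorm (Sum.inr J) := by
    intro Bh hBh hle
    rw [hlen, hdistL, ← hcζ]
    calc B * Bh * (geo9Y x).len y ^ (1 - α) * cζ * Real.exp (-(δc / 6 * (geo9Y x).dist y y')) * (M₂ * (geo9Y x).supNorm (Sum.inr J))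
        = (M₂ * (B * Bh)) * ((geo9Y x).len y ^ (1 - α) * cζ * Real.exp (-(δc / 6 * (geo9Y x).dist y y')) * (geo9Y x).supNorm (Sum.inr J)) := by ring
      _ ≤ W5 * ((geo9Y x).len y ^ (1 - α) * cζ * Real.exp (-(δc / 6 * (geo9Y x).dist y y')) * (geo9Y x).supNorm (Sum.inr J)) :=
          mul_le_mul_of_nonneg_right hle hfacN
      _ = _ := by ring
  have hwL : M₂ * (B * BhL) ≤ W5 := by
    rw [hW5def, wHG6, hBhL, ← hBp]
    have h1 : 0 ≤ Sb * Bp * (1 + (mN : ℝ) * (M₂ * Sb) * Real.exp (δc * (2 * ((d : ℝ) + 1)))) +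
        Sb * (M₂ * Sb * B₀) * (L ^ 3 * Real.exp δc + cLip * L ^ 2 * Real.exp (δc * (rL + 1))) := by positivity
    have h2 : M₂ * (B * (Sb * Bp)) = M₂ * B * (Sb * Bp) := by ring
    rw [h2]
    exact mul_le_mul_of_nonneg_left (le_add_of_nonneg_right h1) (mul_nonneg hM₂ hB)
  have hwR : M₂ * (B * BhR) ≤ W5 := by
    rw [hW5def, wHG6, hBhR, hBhX, hBhA, ← hBp]
    have h2 : M₂ * (B * (Sb * Bp * (1 + (mN : ℝ) * (M₂ * Sb) * Real.exp (δc * (2 * ((d : ℝ) + 1)))) +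
        Sb * (M₂ * Sb * B₀) * (L ^ 3 * Real.exp δc + cLip * L ^ 2 * Real.exp (δc * (rL + 1))))) =
        M₂ * B * (Sb * Bp * (1 + (mN : ℝ) * (M₂ * Sb) * Real.exp (δc * (2 * ((d : ℝ) + 1)))) +
          Sb * (M₂ * Sb * B₀) * (L ^ 3 * Real.exp δc + cLip * L ^ 2 * Real.exp (δc * (rL + 1)))) := by ring
    rw [h2]
    exact mul_le_mul_of_nonneg_left (le_add_of_nonneg_left hBhL0) (mul_nonneg hM₂ hB)
  exact h1ReadB_le_of_probes x.toKIdx TW (parB U) U J α z hRHS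
    (fun E ν q q' hadm => (hLeft E ν q q' hadm).trans (hfinal hBhL0 hwL))
    (fun E ν q q' hadm => (hRight E ν q q' hadm).trans (hfinal hBhR0 hwR))

end Transfer

/-! ## §3 ★★★ The frame instance over the coded carriers of a subfamily and the (3.43) block-step of the bond family -/

section Steps

variable [NormOneClass 𝔸] [FiniteDimensional ℝ 𝔸] {J : Type} (f : J → MemberY d ℓ hd hL b₀ b₁ Mstar)
  [∀ x : MemberY d ℓ hd hL b₀ b₁ Mstar, Fintype (geo9Y x).Site]
  [instDS : ∀ x : MemberY d ℓ hd hL b₀ b₁ Mstar, DecidableEq (geo9Y x).Site] [instNE : ∀ x : MemberY d ℓ hd hL b₀ b₁ Mstar, Nonempty (geo9Y x).Site]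
  (c35 : ℝ) (G : Subgroup 𝔸ˣ) (par : ∀ j : J, SiteParY 𝔸 (f j).toKIdx) (parB : ∀ j : J, BondParY 𝔸 (f j).toKIdx)
  {ι : Type} [Fintype ι] [DecidableEq ι] (b : Module.Basis ι ℝ 𝔸) (ιB : ∀ j : J, BlkY (f j).toKIdx → IBondY (f j).toKIdx)
  (C37 C38 : ∀ j : J, ℝ → CfgY 𝔸 (f j).toKIdx → AfldY 𝔸 (f j).toKIdx → Prop)

/-- ★★★ **THE (3.43) BOND-SECTOR FRAME OVER THE CODED CARRIERS OF A SUBFAMILY, INHABITED FOR `KACU`**: gen 13's instance `gFrame₅CodedOn` (40 fields: the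
letters `GbC ∕ QbC ∕ QsbC ∕ abC ∕ F₂C ∕ F₂sC ∕ LapBC`, the laws, the (3.42) read ∕ write fields) extended by the writing function `wHG6`, `wHGδ δc = δc∕6`, and the transfer
field `h1G_transfer_KACU`.  Displayed beyond `gFrame₅CodedOn`'s binders: the bond transporter law `hLipB` (`Reg335 ⇒ HolderLipBY c_Lip r_L (parB U) U`) and
`hMr : r_L + 1 < MInv`. [cite: Balaban1985BackgroundPropagators, Thm 3.4 p.400, Thm 3.3 p.399, (3.43) p.398, p.403 l.1–9, (3.82)–(3.86) p.407; Balaban1984PropagatorsII, Lemma 2.1 p.234, (2.51)–(2.52) p.232] -/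
noncomputable def h1GFrame₆CodedOn (hι : ∀ (j : J) (s : BlkY (f j).toKIdx), β (f j).toKIdx.hN (f j).toKIdx.D (f j).toKIdx.hk (ιB j s) = s)
    (hG1 : ∀ u : 𝔸ˣ, u ∈ G → ‖(u : 𝔸)‖ ≤ 1) (hpar : ∀ j (U : CfgY 𝔸 (f j).toKIdx), GVal G (f j).toKIdx U → ∀ z w, par j U z w ∈ G)
    (hunit : ∀ j (U : CfgY 𝔸 (f j).toKIdx), GVal G (f j).toKIdx U → IsUnit (deltaPrimeAY (f j).toKIdx (par j) U))
    (M₂ : ℝ) (hM₂ : 0 ≤ M₂) (hrepr : ∀ (v : 𝔸) (j : ι), |b.repr v j| ≤ M₂ * ‖v‖) (hcR : 0 < M₂ * ∑ j, ‖b j‖)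
    (Cq : ℝ) (hCq : 0 ≤ Cq) (hC37 : ∀ j β' U a, C37 j β' U a → GVal G (f j).toKIdx U ∧ CplxLettersY G (f j) (par j) (ιB j) Cq β' U a)
    (MInv aInv aW : ℝ) (hMInv : 0 < MInv) (haInv : 0 < aInv) (haW : 0 < aW)
    (hunitX : ∀ j (U : CfgY 𝔸 (f j).toKIdx), GVal G (f j).toKIdx U → IsUnit (XY (f j).toKIdx (par j) (GpY (f j).toKIdx (par j)) U))
    (hsym : ∀ j (U : CfgY 𝔸 (f j).toKIdx) (z w : SiteY (f j).toKIdx), par j U z w = (par j U w z)⁻¹)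
    (hunitA : ∀ j (U : CfgY 𝔸 (f j).toKIdx), GVal G (f j).toKIdx U → IsUnit (deltaAY (f j).toKIdx (par j) (parB j) (GpY (f j).toKIdx (par j)) U))
    (hparB : ∀ j (U : CfgY 𝔸 (f j).toKIdx), GVal G (f j).toKIdx U → ∀ y f', parB j U y f' ∈ G) (hb₁ : 0 ≤ b₁)
    (C₀ : ℝ) (hC₀ : 0 ≤ C₀)
    (hreg335P : ∀ j (α₀ : ℝ) (U : CfgY 𝔸 (f j).toKIdx), MInv ≤ (geo9Y (f j)).M → 0 < α₀ → (geo9Y (f j)).M * α₀ ≤ aInv →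
      (bg9Y 𝔸 G (f j)).Reg335 c35 α₀ U → Reg335PlaqY G (f j) (ιB j) C₀ U)
    (hC37G : ∀ j β' U a, C37 j β' U a → CplxLettersGY G (f j) (ιB j) β' U a)
    (cVar : ℝ) (hcVar : 0 ≤ cVar) (hvarB : ∀ j β' U a, C37 j β' U a → VarParBY (f j).toKIdx (parB j) cVar β' U a)
    (hMd : 2 * ((d : ℝ) + 1) < MInv) (mN : ℕ) (hnbr : ∀ (j : J) (y' : IBondY (f j).toKIdx), (nbr (geo9Y (f j)) (2 * ((d : ℝ) + 1)) y').card ≤ mN)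
    {cLip rL : ℝ} (hcLip : 0 ≤ cLip) (hrL : 0 ≤ rL)
    (hLipB : ∀ (j : J) (α₀ : ℝ) (U : CfgY 𝔸 (f j).toKIdx), (bg9Y 𝔸 G (f j)).Reg335 c35 α₀ U → HolderLipBY (f j).toKIdx cLip rL (parB j U) U)
    (hMr : rL + 1 < MInv) :
    H1GFrame₆ c35 (fun j => geo9Y (f j)) (fun j => (codingYx G (f j) (C37 j) (C38 j)).bg) (fun j => KSC G (f j) (par j) (C37 j) (C38 j)) b (Fin (d + 1))
      (fun j => SiteY (f j).toKIdx) (fun j => BlkY (f j).toKIdx × ι)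
      (fun j => KACU G (f j) (GAY (f j).toKIdx (par j) (parB j) (GpY (f j).toKIdx (par j))) (parB j) (C37 j) (C38 j))
      (fun j => pullS (codingYx G (f j) (C37 j) (C38 j)) (CinvY f G par j)) :=
  { gFrame₅CodedOn f c35 G par parB b ιB C37 C38 hι hG1 hpar hunit M₂ hM₂ hrepr hcR Cq hCq hC37 MInv aInv aW hMInv haInv haW hunitX hsym hunitA hparB hb₁ C₀
      hC₀ hreg335P hC37G cVar hcVar hvarB hMd mN hnbr with
    wHG := fun B₀ B δc Bβ => wHG6 (2 * ((d : ℝ) + 1)) (((ℓ + 1 : ℕ) : ℝ)) (∑ j, ‖b j‖) M₂ (M₂ * ∑ j, ‖b j‖) cLip rL mN B₀ B δc Bβ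
    wHGδ := fun δc => δc / 6
    wHGδ_pos := fun δc hδc => by positivity
    h1G_transfer := fun j α₀ c c' α₁ B₀ B δ δc Bβ hM hα₀ hMa hreg hα₁ haW' h37 hB₀ hB hδ hδc hδcδ hE hH1 HL HR =>
      h1G_transfer_KACU c35 G (f j) (par j) (parB j) b (ιB j) (C37 j) (C38 j) (hι j) hG1 (hparB j) hM₂ hrepr hcLip hrL (hLipB j)
        (fun _ => hnbr j) hMr (fun δ' => M₂ * (∑ j, ‖b j‖) + cXY (d := d) (ℓ := ℓ) b M₂ mN δ') α₀ c c' α₁ B₀ B δ δc Bβ hM hα₀ hMa hreg hα₁ haW' h37 hB₀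
        hB hδ hδc hδcδ (le_add_of_nonneg_right (cXY_nonneg (d := d) (ℓ := ℓ) b hM₂ mN δ)) hE hH1 HL HR }

/-- ★★ **`StepH1Pos` OF THE CODED BOND FAMILY `KACU` THROUGH THE (3.43) FRAME — THE (3.43) MEMBER OF THE SECT.-B STEP OF RECORD, G SIDE** (r06's
`stepH1Pos_of_h1GFrame₆` on `h1GFrame₆CodedOn`), GIVEN the Lemma-2.1 datum `(d261, h261)` of the frame; site family `KSC`, output family
`KACU G (f j) (GAY … (par j) (parB j) (GpY (par j))) (parB j) …`. [cite: Balaban1985BackgroundPropagators, Thm 3.4 p.400, Thm 3.3 p.399, (3.43) p.398, (3.82)–(3.86) p.407; Balaban1984PropagatorsII, Lemma 2.1 p.234, (2.51) p.232] -/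
theorem stepH1Pos_KACU_frame_on (hι : ∀ (j : J) (s : BlkY (f j).toKIdx), β (f j).toKIdx.hN (f j).toKIdx.D (f j).toKIdx.hk (ιB j s) = s)
    (hG1 : ∀ u : 𝔸ˣ, u ∈ G → ‖(u : 𝔸)‖ ≤ 1) (hpar : ∀ j (U : CfgY 𝔸 (f j).toKIdx), GVal G (f j).toKIdx U → ∀ z w, par j U z w ∈ G)
    (hunit : ∀ j (U : CfgY 𝔸 (f j).toKIdx), GVal G (f j).toKIdx U → IsUnit (deltaPrimeAY (f j).toKIdx (par j) U))
    (M₂ : ℝ) (hM₂ : 0 ≤ M₂) (hrepr : ∀ (v : 𝔸) (j : ι), |b.repr v j| ≤ M₂ * ‖v‖) (hcR : 0 < M₂ * ∑ j, ‖b j‖)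
    (Cq : ℝ) (hCq : 0 ≤ Cq) (hC37 : ∀ j β' U a, C37 j β' U a → GVal G (f j).toKIdx U ∧ CplxLettersY G (f j) (par j) (ιB j) Cq β' U a)
    (MInv aInv aW : ℝ) (hMInv : 0 < MInv) (haInv : 0 < aInv) (haW : 0 < aW)
    (hunitX : ∀ j (U : CfgY 𝔸 (f j).toKIdx), GVal G (f j).toKIdx U → IsUnit (XY (f j).toKIdx (par j) (GpY (f j).toKIdx (par j)) U))
    (hsym : ∀ j (U : CfgY 𝔸 (f j).toKIdx) (z w : SiteY (f j).toKIdx), par j U z w = (par j U w z)⁻¹)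
    (hunitA : ∀ j (U : CfgY 𝔸 (f j).toKIdx), GVal G (f j).toKIdx U → IsUnit (deltaAY (f j).toKIdx (par j) (parB j) (GpY (f j).toKIdx (par j)) U))
    (hparB : ∀ j (U : CfgY 𝔸 (f j).toKIdx), GVal G (f j).toKIdx U → ∀ y f', parB j U y f' ∈ G) (hb₁ : 0 ≤ b₁)
    (C₀ : ℝ) (hC₀ : 0 ≤ C₀)
    (hreg335P : ∀ j (α₀ : ℝ) (U : CfgY 𝔸 (f j).toKIdx), MInv ≤ (geo9Y (f j)).M → 0 < α₀ → (geo9Y (f j)).M * α₀ ≤ aInv →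
      (bg9Y 𝔸 G (f j)).Reg335 c35 α₀ U → Reg335PlaqY G (f j) (ιB j) C₀ U)
    (hC37G : ∀ j β' U a, C37 j β' U a → CplxLettersGY G (f j) (ιB j) β' U a)
    (cVar : ℝ) (hcVar : 0 ≤ cVar) (hvarB : ∀ j β' U a, C37 j β' U a → VarParBY (f j).toKIdx (parB j) cVar β' U a)
    (hMd : 2 * ((d : ℝ) + 1) < MInv) (mN : ℕ) (hnbr : ∀ (j : J) (y' : IBondY (f j).toKIdx), (nbr (geo9Y (f j)) (2 * ((d : ℝ) + 1)) y').card ≤ mN)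
    {cLip rL : ℝ} (hcLip : 0 ≤ cLip) (hrL : 0 ≤ rL)
    (hLipB : ∀ (j : J) (α₀ : ℝ) (U : CfgY 𝔸 (f j).toKIdx), (bg9Y 𝔸 G (f j)).Reg335 c35 α₀ U → HolderLipBY (f j).toKIdx cLip rL (parB j U) U)
    (hMr : rL + 1 < MInv) (d261 : ℝ → ℕ)
    (h261 : ∀ (j : J) (δ α : ℝ), 0 < δ → δ ≤ 1 → 9 / 5000 ≤ α → α < 1 →
      (h1GFrame₆CodedOn f c35 G par parB b ιB C37 C38 hι hG1 hpar hunit M₂ hM₂ hrepr hcR Cq hCq hC37 MInv aInv aW hMInv haInv haW hunitX hsym hunitA hparB hb₁ C₀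
        hC₀ hreg335P hC37G cVar hcVar hvarB hMd mN hnbr hcLip hrL hLipB hMr).M261 δ ≤ (geo9Y (f j)).M →
      Ineq261 (d261 δ) (toB6 (geo9Y (f j)) 0 True) δ α) :
    StepH1Pos (d + 1) c35 (fun j => geo9Y (f j)) (fun j => (codingYx G (f j) (C37 j) (C38 j)).bg) (fun j => KSC G (f j) (par j) (C37 j) (C38 j))
      (fun j => KACU G (f j) (GAY (f j).toKIdx (par j) (parB j) (GpY (f j).toKIdx (par j))) (parB j) (C37 j) (C38 j))
      (fun j => pullS (codingYx G (f j) (C37 j) (C38 j)) (CinvY f G par j))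
      (fun j => KACU G (f j) (GAY (f j).toKIdx (par j) (parB j) (GpY (f j).toKIdx (par j))) (parB j) (C37 j) (C38 j)) :=
  stepH1Pos_of_h1GFrame₆ (F := h1GFrame₆CodedOn f c35 G par parB b ιB C37 C38 hι hG1 hpar hunit M₂ hM₂ hrepr hcR Cq hCq hC37 MInv aInv aW hMInv haInv haW
    hunitX hsym hunitA hparB hb₁ C₀ hC₀ hreg335P hC37G cVar hcVar hvarB hMd mN hnbr hcLip hrL hLipB hMr) d261 h261

end Steps

end Literature.MathematicalPhysics.QuantumFieldTheory.Balaban1983to89.B9SectBH1GFrameCodedY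

end
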